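import Literature.Computability.Cryptography.IndepLawBridge
import HarnessLib

/-!
# Independent trials: expectations of product functions and majority amplification

Topic `Computability/Cryptography` (LWE), grouping namespace `LWE`, on top of the tree's product
laws `Literature.Probability.Distributions.indepLaw K p` (`IndepProductLaw.lean`: `K` independent,
not necessarily identically distributed coordinates, `indepLaw_apply`), `LWE.iidPMF`
(`indepLaw_const`, `IndepLawBridge.lean`) and `LWE.blocksOf` (`LWEProductLaws.lean`: `K·u` iid
samples regrouped into `K` blocks, `iidPMF_map_blocksOf`). Finite-probability toolkit for the
AVERAGE-CASE-TO-WORST-CASE bridge of search-`LWE` (hypothesis `h₁` of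
`Literature.Computability.Cryptography.regev_lwe_to_sivp_quantum_of_worstCase`,
`RegevDGSReductionWorstCase.lean`: Regev 2009, proof of Lemma 4.1 — random self-reduction in the
secret — followed by the standard amplification "repeat with fresh samples and take the majority
answer", Arora–Barak 2009, §7.4.1, proof of Thm 7.10, in the elementary exponential-moment form):

* `ENNReal.tsum_pi_fin_prod` — `∑_{v : Fin K → α} ∏ⱼ Fⱼ(vⱼ) = ∏ⱼ ∑_a Fⱼ(a)` (also for infinite `α`,
  as `tsum`s in `ℝ≥0∞`), whence **`tsum_indepLaw_mul_prod`**: expectations of product functions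
  factor under independence, `E[∏ⱼ gⱼ(Xⱼ)] = ∏ⱼ E[gⱼ(Xⱼ)]`; one-coordinate corollaries
  `tsum_indepLaw_mul_apply`, `indepLaw_toOuterMeasure_apply_preimage`;
* `PMF.toOuterMeasure_setOf_le_div` — Markov's inequality for a `PMF`;
* **`indepLaw_toOuterMeasure_half_le`** — MAJORITY AMPLIFICATION: if coordinate `j` is *bad* with
  probability `≤ fⱼ`, then at least half of the `K` coordinates are bad with probability
  `≤ ∏ⱼ (1 + fⱼ) / (√2)^K` (Markov on `2^{#bad}`, whose expectation is `∏ⱼ (1 + Pr[bad j])` by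
  independence; with `fⱼ ≤ 1/3 + 1/100` this is `≤ 0.95^K`);
* `tsum_map_mul` (change of variables) and **`tsum_iidPMF_mul_prod_blocksOf`**:
  `E_{p^{⊗Ku}}[∏ⱼ φⱼ(block j)] = ∏ⱼ E_{p^{⊗u}}[φⱼ]`.

Everything here is PROVED (one definition with a body, `badCount`; theorems).

## References

* S. Arora, B. Barak, *Computational Complexity: A Modern Approach*, CUP 2009, §7.4.1 (error
  reduction by majority, proof of Thm 7.10) and §A.2 (Markov's inequality, independence)
  [AroraBarak2009].
* O. Regev, *On lattices, learning with errors, random linear codes, and cryptography*, J. ACM 56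
  (2009), art. 34, §2 (p. 12: "`m` independent samples", "probability exponentially close to 1") and
  proof of Lemma 4.1 [Regev2009].
-/

noncomputable section

open scoped ENNReal

/-! ### Sums of product functions over `Fin K → α` -/

namespace ENNReal

/-- **`∑_{v : Fin K → α} ∏ⱼ Fⱼ(vⱼ) = ∏ⱼ ∑_a Fⱼ(a)`** in `ℝ≥0∞`, for an arbitrary type `α` (sums as
`tsum`s): induction on `K` along `Fin.consEquiv`. [cite: AroraBarak2009, §A.2 (independent random variables: E[XY] = E[X]E[Y])] -/
theorem tsum_pi_fin_prod {α : Type} : ∀ (K : ℕ) (F : Fin K → α → ℝ≥0∞),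
    ∑' v : Fin K → α, ∏ j, F j (v j) = ∏ j, ∑' a, F j a
  | 0, F => by simp
  | K + 1, F => by
    calc ∑' v : Fin (K + 1) → α, ∏ j, F j (v j)
        = ∑' aw : α × (Fin K → α), ∏ j, F j ((Fin.consEquiv fun _ : Fin (K + 1) => α) aw j) :=
          ((Fin.consEquiv fun _ : Fin (K + 1) => α).tsum_eq (fun v => ∏ j, F j (v j))).symm
      _ = ∑' aw : α × (Fin K → α), F 0 aw.1 * ∏ j, F j.succ (aw.2 j) := by
          refine tsum_congr fun aw => ?_
          rw [Fin.prod_univ_succ]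
          simp [Fin.consEquiv]
      _ = ∑' a, ∑' w : Fin K → α, F 0 a * ∏ j : Fin K, F j.succ (w j) :=
          ENNReal.tsum_prod (f := fun a (w : Fin K → α) => F 0 a * ∏ j : Fin K, F j.succ (w j))
      _ = ∑' a, F 0 a * ∑' w : Fin K → α, ∏ j : Fin K, F j.succ (w j) := by
          simp_rw [ENNReal.tsum_mul_left]
      _ = (∑' a, F 0 a) * ∏ j : Fin K, ∑' a, F j.succ a := by
          rw [ENNReal.tsum_mul_right, tsum_pi_fin_prod K (fun j => F j.succ)]
      _ = ∏ j, ∑' a, F j a := by rw [Fin.prod_univ_succ]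

end ENNReal

namespace Literature.Computability.Cryptography

namespace LWE

open Literature.Probability.Distributions

variable {α : Type}

/-! ### Expectations under the independent product law -/

/-- **Expectations of product functions factor under independence**:
`∑_v indepLaw(v) ∏ⱼ gⱼ(vⱼ) = ∏ⱼ ∑_a pⱼ(a) gⱼ(a)`. [cite: AroraBarak2009, §A.2 (E[XY] = E[X]E[Y] for independent X, Y)] -/
theorem tsum_indepLaw_mul_prod (K : ℕ) (p : Fin K → PMF α) (g : Fin K → α → ℝ≥0∞) :
    ∑' v : Fin K → α, indepLaw K p v * ∏ j, g j (v j) = ∏ j, ∑' a, p j a * g j a := by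
  simp_rw [indepLaw_apply, ← Finset.prod_mul_distrib]
  exact ENNReal.tsum_pi_fin_prod K fun j a => p j a * g j a

/-- The expectation of a function of one coordinate is its expectation under that coordinate's law.
[folklore] -/
theorem tsum_indepLaw_mul_apply (K : ℕ) (p : Fin K → PMF α) (j₀ : Fin K) (g : α → ℝ≥0∞) :
    ∑' v : Fin K → α, indepLaw K p v * g (v j₀) = ∑' a, p j₀ a * g a := by
  classical
  have h := tsum_indepLaw_mul_prod K p fun j a => if j = j₀ then g a else 1
  simp only [Finset.prod_ite_eq', Finset.mem_univ, if_true] at h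
  rw [h, Finset.prod_eq_single j₀ (fun j _ hj => by simp [hj]) (fun hj => absurd (Finset.mem_univ _) hj)]
  simp

/-- The probability of an event of one coordinate is that coordinate's probability. [folklore] -/
theorem indepLaw_toOuterMeasure_apply_preimage (K : ℕ) (p : Fin K → PMF α) (j₀ : Fin K) (D : Set α) :
    (indepLaw K p).toOuterMeasure {v | v j₀ ∈ D} = (p j₀).toOuterMeasure D := by
  classical
  rw [PMF.toOuterMeasure_apply, PMF.toOuterMeasure_apply]
  have h := tsum_indepLaw_mul_apply K p j₀ (D.indicator fun _ => 1)
  have e1 : ∀ v : Fin K → α, indepLaw K p v * D.indicator (fun _ => (1 : ℝ≥0∞)) (v j₀) =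
      Set.indicator {v | v j₀ ∈ D} (indepLaw K p) v := fun v => by
    by_cases hv : v j₀ ∈ D
    · rw [Set.indicator_of_mem hv, Set.indicator_of_mem (show v ∈ {v | v j₀ ∈ D} from hv), mul_one]
    · rw [Set.indicator_of_notMem hv, Set.indicator_of_notMem (show v ∉ {v | v j₀ ∈ D} from hv), mul_zero]
  have e2 : ∀ a, p j₀ a * D.indicator (fun _ => (1 : ℝ≥0∞)) a = D.indicator (p j₀) a := fun a => by
    by_cases ha : a ∈ D
    · rw [Set.indicator_of_mem ha, Set.indicator_of_mem ha, mul_one]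
    · rw [Set.indicator_of_notMem ha, Set.indicator_of_notMem ha, mul_zero]
  simp_rw [e1, e2] at h
  exact h

/-! ### Markov's inequality and majority amplification -/

/-- **Markov's inequality** for a `PMF`: `Pr[c ≤ g] ≤ E[g] / c` (`0 < c < ∞`).
[cite: AroraBarak2009, §A.2 (Markov's inequality)] -/
theorem _root_.PMF.toOuterMeasure_setOf_le_div {Ω : Type} (μ : PMF Ω) (g : Ω → ℝ≥0∞) {c : ℝ≥0∞}
    (hc : c ≠ 0) (hc' : c ≠ ⊤) :
    μ.toOuterMeasure {v | c ≤ g v} ≤ (∑' v, μ v * g v) / c := by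
  rw [ENNReal.le_div_iff_mul_le (Or.inl hc) (Or.inl hc'), PMF.toOuterMeasure_apply, ← ENNReal.tsum_mul_right]
  refine ENNReal.tsum_le_tsum fun v => ?_
  by_cases hv : v ∈ {v | c ≤ g v}
  · rw [Set.indicator_of_mem hv]
    exact mul_le_mul' le_rfl hv
  · rw [Set.indicator_of_notMem hv, zero_mul]
    exact zero_le

/-- The number of bad coordinates of a tuple. [folklore] -/
def badCount {K : ℕ} (D : Fin K → Set α) [∀ j, DecidablePred (· ∈ D j)] (v : Fin K → α) : ℕ :=
  (Finset.univ.filter fun j => v j ∈ D j).card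

/-- `2^{#bad}` is the product of the per-coordinate factors `2` (bad) / `1` (good). [folklore] -/
theorem two_pow_badCount {K : ℕ} (D : Fin K → Set α) [∀ j, DecidablePred (· ∈ D j)] (v : Fin K → α) :
    (2 : ℝ≥0∞) ^ badCount D v = ∏ j, (if v j ∈ D j then (2 : ℝ≥0∞) else 1) := by
  rw [Finset.prod_ite, Finset.prod_const, Finset.prod_const_one, mul_one]
  rfl

/-- The per-coordinate factor has expectation `1 + Pr[bad j]`. [folklore] -/
theorem tsum_mul_ite_two_one (p : PMF α) (D : Set α) [DecidablePred (· ∈ D)] :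
    ∑' a, p a * (if a ∈ D then (2 : ℝ≥0∞) else 1) = 1 + p.toOuterMeasure D := by
  have e : ∀ a, p a * (if a ∈ D then (2 : ℝ≥0∞) else 1) = p a + D.indicator p a := fun a => by
    by_cases ha : a ∈ D
    · rw [if_pos ha, Set.indicator_of_mem ha, mul_two]
    · rw [if_neg ha, Set.indicator_of_notMem ha, mul_one, add_zero]
  simp_rw [e]
  rw [ENNReal.tsum_add, PMF.tsum_coe, PMF.toOuterMeasure_apply]

/-- `(√2)^(2N) = 2^N` in `ℝ≥0∞`. [folklore] -/
theorem sqrt_two_pow_two_mul (N : ℕ) : ((NNReal.sqrt 2 : NNReal) : ℝ≥0∞) ^ (2 * N) = 2 ^ N := by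
  rw [pow_mul, ← ENNReal.coe_pow, NNReal.sq_sqrt]
  norm_cast

/-- **Majority amplification** (independent, not necessarily identical trials): if coordinate `j`
is bad with probability at most `fⱼ`, then at least half of the `K` coordinates are bad with
probability at most `∏ⱼ (1 + fⱼ) / (√2)^K` — Markov's inequality for `2^{#bad}`, whose expectation
is `∏ⱼ (1 + Pr[bad j])` by independence. (With `fⱼ ≤ 1/3 + 1/100`, `(1 + fⱼ)/√2 ≤ 0.95`: the failure
probability of "repeat `K` times, take the majority" decays exponentially in `K`.)
[cite: AroraBarak2009, §7.4.1 (proof of Thm 7.10: error reduction by majority)] -/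
theorem indepLaw_toOuterMeasure_half_le (K : ℕ) (p : Fin K → PMF α) (D : Fin K → Set α)
    [∀ j, DecidablePred (· ∈ D j)] (f : Fin K → ℝ≥0∞) (hf : ∀ j, (p j).toOuterMeasure (D j) ≤ f j) :
    (indepLaw K p).toOuterMeasure {v | K ≤ 2 * badCount D v} ≤
      (∏ j, (1 + f j)) / ((NNReal.sqrt 2 : NNReal) : ℝ≥0∞) ^ K := by
  set s : ℝ≥0∞ := ((NNReal.sqrt 2 : NNReal) : ℝ≥0∞) with hs
  have hs1 : 1 ≤ s := by
    rw [hs, ← ENNReal.coe_one, ENNReal.coe_le_coe]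
    exact NNReal.one_le_sqrt.2 one_le_two
  have hs0 : s ^ K ≠ 0 := pow_ne_zero _ (ne_of_gt (lt_of_lt_of_le zero_lt_one hs1))
  have hsT : s ^ K ≠ ⊤ := ENNReal.pow_ne_top ENNReal.coe_ne_top
  -- {half bad} ⊆ {s^K ≤ 2^{#bad}}
  have hsub : {v : Fin K → α | K ≤ 2 * badCount D v} ⊆ {v | s ^ K ≤ (2 : ℝ≥0∞) ^ badCount D v} := by
    intro v hv
    have h1 : s ^ K ≤ s ^ (2 * badCount D v) := pow_le_pow_right' hs1 hv
    rw [hs, sqrt_two_pow_two_mul] at h1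
    exact h1
  refine ((indepLaw K p).toOuterMeasure.mono hsub).trans ?_
  refine (PMF.toOuterMeasure_setOf_le_div _ _ hs0 hsT).trans ?_
  gcongr
  -- E[2^{#bad}] = ∏ (1 + Pr[bad j]) ≤ ∏ (1 + f j)
  simp_rw [two_pow_badCount]
  refine (tsum_indepLaw_mul_prod K p fun j a => if a ∈ D j then (2 : ℝ≥0∞) else 1).le.trans ?_
  exact Finset.prod_le_prod' fun j _ => by rw [tsum_mul_ite_two_one]; exact add_le_add le_rfl (hf j)

/-! ### Blocks of iid samples -/

/-- **Change of variables for expectations**: `∑_S μ(S) Φ(f S) = ∑_v (μ.map f)(v) Φ(v)`. [folklore] -/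
theorem tsum_map_mul {β γ : Type} (μ : PMF β) (f : β → γ) (Φ : γ → ℝ≥0∞) :
    ∑' v, μ.map f v * Φ v = ∑' S, μ S * Φ (f S) := by
  classical
  simp_rw [PMF.map_apply, ← ENNReal.tsum_mul_right]
  rw [ENNReal.tsum_comm]
  refine tsum_congr fun S => ?_
  rw [tsum_eq_single (f S)]
  · rw [if_pos rfl]
  · intro v hv; rw [if_neg hv, zero_mul]

/-- **Expectations of products of per-block functions factor**:
`E_{p^{⊗ Ku}}[∏ⱼ φⱼ(block j)] = ∏ⱼ E_{p^{⊗ u}}[φⱼ]` (blocks `LWE.blocksOf`). [cite: AroraBarak2009, §A.2 (independence)] -/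
theorem tsum_iidPMF_mul_prod_blocksOf (p : PMF α) (K u : ℕ) (φ : Fin K → (Fin u → α) → ℝ≥0∞) :
    ∑' S : Fin (K * u) → α, iidPMF p (K * u) S * ∏ j, φ j (blocksOf K u S j) =
      ∏ j, ∑' b : Fin u → α, iidPMF p u b * φ j b := by
  rw [← tsum_map_mul (iidPMF p (K * u)) (blocksOf K u) (fun v => ∏ j, φ j (v j)), iidPMF_map_blocksOf,
    ← indepLaw_const, tsum_indepLaw_mul_prod]

end LWE

end Literature.Computability.Cryptography
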